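import Literature.AnabelianGeometry.EtaleTheta.Discharge.Sec4NonVacuityNoRootsL01a
import Literature.AnabelianGeometry.EtaleTheta.Discharge.Sec4NonVacuityCoveringL03
import Literature.AnabelianGeometry.EtaleTheta.Discharge.Sec4Prop42SubRootPair
import HarnessLib

/-!
# [EtTh] Prop. 4.2 (iii), sub-nodes L01b / L01 / L02 / L03 (`SaturatedRefinement`, `SaturatedRootCover`,
# `RootFractionPair`, `BaseFrobeniusLift`): the UNIVERSAL CLOSURES are refuted in the kernel, the
# instance forms at the toys of record are proved

S. Mochizuki, *The étale theta function and its Frobenioid-theoretic manifestations*, Publ. RIMS **45**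
(2009) [MochizukiEtTh2009], §4, Prop. 4.2 (iii) p.88 (PDF), proof p.89 l.76 – p.90 l.11; the sub-DAG
`plan/L2/SUBDAG-EtTh-Prop42.md` rows L01b `SaturatedRefinement` («[FrdII], Remark 2.2.1 [concerning the
issue of "(N, H_⊙^{bs-fld})-saturation"]», p.90), L01 `SaturatedRootCover` (= L01a + L01b, Def. 4.1 (iii)
p.87), L02 `RootFractionPair` («Φ perfect … [FrdI], Definition 1.3, (iii), (d)», p.89), L03
`BaseFrobeniusLift` («C admits a base-Frobenius pair [cf. [FrdI], Definition 2.7, (iii)]», p.89) of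
abc-iut-w5-d134's statements file `Prop42Sub.lean`.  FACT-LIST rows F-2793 (`SaturatedRefinement`),
F-2794 (`SaturatedRootCover`), F-2795 (`RootFractionPair`), F-2796 (`BaseFrobeniusLift`) of the abc-iut
cell (tranche 129, seat abc-iut-f-129).

PROOF-ONLY companion (no definition, no named fact, no instance, no `sorry`); nothing in `Prop42Sub.lean`,
`BiKummer*.lean` or the `Discharge/Sec4*` files of record is edited or restated.  Every row is a
PREDICATE over the §4 hypothesis structure `S : BiKummerSetting X T D VD` (abc-iut-L2-t3; its birational
vocabulary `O^×(A^birat)`, `s'·(s'')⁻¹`, its `(N, H^{bs-fld})`-saturation slot and its "arise from a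
base-Frobenius pair" slot are FREE fields, TODO-merge abc-iut-L1-t2/t3/t4) and, for L01b/L01/L02, over a
free transport parameter `pullFrac` ("`((α')^birat)^*`", [FrdI] Prop. 1.11 (iv)).  What is shown:

* **F-2794 / L01.** `Toy.not_saturatedRootCover`: at the cover-free toy `Toy.biKummerSetting`
  (p418516; no constants, `O^×(A) = 1`) NO object is `μ_2`-saturated (`Toy.not_isMuSaturated`,
  `Sec4NonVacuityNoRootsL01a.lean`), so L01 fails for EVERY transport; independently,
  `Prop42Sub.not_saturatedRootCover_of_saturationSlot_empty`: at ANY §4 setting whose free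
  `(N, H^{bs-fld})`-saturation slot is empty, Def. 4.1 (iii)(a) is unsatisfiable.  Closed form:
  `Prop42Sub.not_forall_saturatedRootCover`.  MODEL-WITNESS: `ToyCov.saturatedRootCover` (Kummer-tower toy
  p427822, genuine transport `pullFracModel`; from abc-iut-w5-d063's `ToyCov.saturatedRootCoverInSkeleton` by
  `saturatedRootCover_of_inSkeleton`).
* **F-2793 / L01b.** `Prop42Sub.not_saturatedRefinement_of_saturationSlot_empty`: with the saturation slot
  empty, the premises of L01b are met at `N = 1`, `A' = A_⊙`, `φ = id` (every object is `μ_1`-saturated,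
  `isMuSaturated_one`) while no refinement can be `(1, H_⊙, f)`-saturated.  Closed form:
  `Prop42Sub.not_forall_saturatedRefinement`.  POSITIVE: `Toy.saturatedRefinement` — at the cover-free toy
  (slot := `True`) L01b HOLDS FOR EVERY transport, hypothesis-free (refinement `ψ = id`; for `N ≥ 2` the
  premise "`A'` is `μ_N`-saturated" is empty); `ToyCov.saturatedRefinement` (p428415) is the model form of
  record.  So the only obstruction to the closure of L01b exhibited here is the FREE Def. 4.1 (iii)(a) slot —
  consistent with abc-iut-w5-d120's CONDITIONAL `saturatedRefinement_treeCatVocab_of_laws` (p430520: modulo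
  the [FrdII] Rmk. 2.2.1 law `hE`, GAP G-w4d044-2).
* **F-2795 / L02.** `Prop42Sub.not_rootFractionPair_of_isEmpty_fractionPair`: L02 requires the root
  `g := pullFrac(id)(f)` to POSSESS a fraction-pair; `Prop42Sub.not_forall_rootFractionPair`: at the §4
  setting over `Toy.temperedFrobenioidQ` with its free birational slots filled degenerately
  (`O^×(A^birat) := ℤˣ`, `s'·(s'')⁻¹ := 1`) and the constant transport `pullFrac := −1`, the trivial
  fraction-pair `(id, id)` of `f = 1` has the root `g = −1` (`N = 1`) with no fraction-pair.  MODEL-WITNESS: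
  `ToyCov.rootFractionPair` — L02 HOLDS at the Kummer-tower toy for the genuine transport (abc-iut-w5-d134's
  `rootFractionPair_mkOfModel` with `Φ = ℚ_{≥0}` divisorial and the two [FrdI] Prop. 4.1 (iii) coprimality
  laws `ToyCov.coprime_of_pow`, `ToyCov.coprime_pull`).
* **F-2796 / L03.** `Prop42Sub.not_forall_baseFrobeniusLift`: the closed form of abc-iut-w5-d063's
  `ToyCov.not_baseFrobeniusLift_and_baseFrobeniusLiftUpToUnit` (p430911; finding F-w4d044-1 of
  abc-iut-w4-d044: a non-trivial unit of `A_⊙` is never `P`-distinguished; superseded row L03′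
  `BaseFrobeniusLiftUpToUnit` holds there).

READING.  A refuted universal closure is a statement about the TYPED INTERFACE (free slots, free transport
parameter), not about [EtTh] Prop. 4.2: print CHOOSES the covering, the transport `((α')^birat)^*` and the
base-Frobenius pair; the rows are consumed per instance (`…_mkOfModelCanonical_of_laws`, `…_treeCatVocab_…`,
the toys above).  CONSISTENCY WITNESSES are toys (one-object resp. Kummer-tower base, trivial [FrdI]
vocabularies): consistency ≠ faithfulness.  Typed ≠ proved.  Nothing here bears on, or takes a side on,
[IUTchIII] Cor. 3.12.
-/

namespace Literature.AnabelianGeometry.EtaleTheta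

open CategoryTheory Opposite Literature.AlgebraicGeometry.Frobenioids

universe u₀ v₀ u v w

variable {K : Type u₀} [Field K]

namespace BiKummerSetting

/-! ## Settings whose `(N, H^{bs-fld})`-saturation slot is EMPTY: Def. 4.1 (iii)(a) never holds -/

namespace Prop42Sub

variable {X : SemiGraphs.TemperedArithmeticGroup.{u₀} K} {D₀ : Type u₀} [Category.{v₀} D₀]
  {V : FrdIMonoidStub.{w}} {T : RealifiedDivisorMonoids (D₀ := D₀) V} {D : Type u} [Category.{v} D]
  {VD : FrdICatStub.{u, v, w} D} (S : BiKummerSetting X T D VD)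

/-- If the FREE `(N, H^{bs-fld})`-saturation slot of a §4 setting ([FrdII] Def. 2.2 (ii); TODO-merge
abc-iut-L1-t4) is EMPTY, no object is `(N, H_⊙, f)`-saturated: condition (a) of Def. 4.1 (iii) asks for
an `(N, H_⊙^{bs-fld})`-saturated Frobenius-trivial object. [cite: MochizukiEtTh2009, Def 4.1 p.87] -/
theorem not_isSaturated_of_saturationSlot_empty
    (hNH : ∀ H (A : S.C) N, ¬ S.IsNHSaturatedBsFld H A N) (A : S.C) (N : ℕ+) (f : S.biratUnits A) :
    ¬ S.IsSaturated A N f := by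
  intro hsat
  obtain ⟨_, A'', _, _, -, -, -, h⟩ := hsat.cond_a
  exact hNH _ A'' N h

/-- **L01b `SaturatedRefinement` FAILS at every §4 setting with empty saturation slot, for every
transport** (row F-2793): its premises are met at `N = 1`, `A' = A_⊙`, `φ = id_{A_⊙}` (an isomorphism is a
pull-back morphism; `A_⊙` is Frobenius-trivial and Galois by the setting; every object is `μ_1`-saturated,
`isMuSaturated_one`; `g := f|` is a first root), but no refinement is `(1, H_⊙, f|)`-saturated.
[cite: MochizukiEtTh2009, Prop 4.2 p.90] -/
theorem not_saturatedRefinement_of_saturationSlot_empty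
    (hNH : ∀ H (A : S.C) N, ¬ S.IsNHSaturatedBsFld H A N)
    (pullFrac : ∀ {A A' : S.C} (_ : A' ⟶ A), S.biratUnits A → S.biratUnits A') (f : S.biratUnits S.Aodot) :
    ¬ SaturatedRefinement S pullFrac := by
  intro h
  obtain ⟨A'', ψ, -, -, -, -, hsat⟩ :=
    h 1 f S.Aodot (𝟙 S.Aodot) (PreFrobenioid.isPullbackMorphism_of_isIso S.F (𝟙 S.Aodot))
      S.isFrobeniusTrivial_Aodot S.isGalois_Aodot (isMuSaturated_one S S.Aodot) ⟨_, pow_one _⟩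
  exact not_isSaturated_of_saturationSlot_empty S hNH A'' 1 _ hsat

/-- **L01 `SaturatedRootCover` FAILS at every §4 setting with empty saturation slot, for every transport**
(row F-2794; obstruction: Def. 4.1 (iii)(a)). [cite: MochizukiEtTh2009, Prop 4.2 p.89] -/
theorem not_saturatedRootCover_of_saturationSlot_empty
    (hNH : ∀ H (A : S.C) N, ¬ S.IsNHSaturatedBsFld H A N)
    (pullFrac : ∀ {A A' : S.C} (_ : A' ⟶ A), S.biratUnits A → S.biratUnits A') (f : S.biratUnits S.Aodot) :
    ¬ SaturatedRootCover S pullFrac := by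
  intro h
  obtain ⟨A', φ, -, -, -, -, hsat⟩ := h 1 f
  exact not_isSaturated_of_saturationSlot_empty S hNH A' 1 _ hsat

/-! ## L02 needs the root to possess a fraction-pair -/

/-- **L02 `RootFractionPair` requires the root to POSSESS a fraction-pair**: if `f ∈ O^×(A_⊙^birat)` has a
fraction-pair but `g := pullFrac(id_{A_⊙})(f)` (a first root of `f|` along the pull-back morphism `id`) has
none, the row fails (instance `N = 1`, `A' = A_⊙`, `φ = id`). [cite: MochizukiEtTh2009, Prop 4.2 p.89] -/
theorem not_rootFractionPair_of_isEmpty_fractionPair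
    {pullFrac : ∀ {A A' : S.C} (_ : A' ⟶ A), S.biratUnits A → S.biratUnits A'}
    {B : S.C} {f : S.biratUnits S.Aodot} (P : S.FractionPair f B)
    (hno : ∀ BN : S.C, IsEmpty (S.FractionPair (pullFrac (𝟙 S.Aodot) f) BN)) :
    ¬ RootFractionPair S pullFrac := by
  intro h
  obtain ⟨BN, Q, -, -⟩ := h f P 1 S.Aodot (𝟙 _) (pullFrac (𝟙 _) f)
    (PreFrobenioid.isPullbackMorphism_of_isIso S.F (𝟙 _)) (by rw [PNat.one_coe, pow_one])
  exact (hno BN).false Q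

end Prop42Sub

end BiKummerSetting

/-! ## The cover-free toy `Toy.biKummerSetting` (p418516): L01 fails (no constants), L01b holds -/

namespace Toy

/-- Automorphism groups in the one-object discrete base category are trivial. [folklore] -/
private theorem subsingleton_aut_base (A : Discrete PUnit.{1}) : Subsingleton (Aut A) :=
  ⟨fun _ _ => Iso.ext (Subsingleton.elim _ _)⟩

/-- **L01 `SaturatedRootCover` FAILS at the cover-free toy, for EVERY transport `pullFrac`** (row F-2794):
at `N = 2`, `f = 1` the row asks for a `μ_2`-saturated object, and the toy has none (`O^×(A) = 1`,
`Toy.not_isMuSaturated`) — the same obstruction as for L01a/L01′ (`Toy.not_rootOverCovering`).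
[cite: MochizukiEtTh2009, Prop 4.2 p.89] -/
theorem not_saturatedRootCover
    (pullFrac : ∀ {A A' : biKummerSetting.C} (_ : A' ⟶ A),
      biKummerSetting.biratUnits A → biKummerSetting.biratUnits A') :
    ¬ BiKummerSetting.Prop42Sub.SaturatedRootCover biKummerSetting pullFrac := by
  intro h
  obtain ⟨A', -, -, -, -, hμ, -⟩ := h 2 1
  exact not_isMuSaturated A' (le_refl 2) hμ

/-- At the cover-free toy every automorphism of every object acts trivially on `O^×(A^birat)` (the action
factors through `Aut_D(A^bs) = 1`). [cite: MochizukiEtTh2009, Def 4.1 p.87] -/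
theorem biratAut_apply_eq_self (A : biKummerSetting.C) (σ : Aut A) (x : biKummerSetting.biratUnits A) :
    biKummerSetting.biratAut A σ x = x := by
  change temperedFrobenioidQ.biratAutModel A σ x = x
  apply Units.ext
  rw [TemperedFrobenioid.coe_biratAutModel_apply,
    show ModelFrobenioid.baseMap σ.inv = 𝟙 A.base from Subsingleton.elim _ _, op_id,
    CategoryTheory.Functor.map_id]
  rfl

/-- **L01b `SaturatedRefinement` HOLDS at the cover-free toy, for EVERY transport `pullFrac`**,
hypothesis-free (row F-2793, positive instance): for `N ≥ 2` the premise "`A'` is `μ_N`-saturated" is empty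
(`Toy.not_isMuSaturated`); for `N = 1` the refinement `ψ := id_{A'}` works — `A'` is `H_⊙`-ample
(`Aut_D = 1`), every birational unit is `H_{A'}`-fixed (`biratAut_apply_eq_self`), Def. 4.1 (iii)(a) holds
with the identity pre-steps (`A'` Frobenius-trivial, slot `True`), and (b) is the given root.
[cite: MochizukiEtTh2009, Prop 4.2 p.90] -/
theorem saturatedRefinement
    (pullFrac : ∀ {A A' : biKummerSetting.C} (_ : A' ⟶ A),
      biKummerSetting.biratUnits A → biKummerSetting.biratUnits A') :
    BiKummerSetting.Prop42Sub.SaturatedRefinement biKummerSetting pullFrac := by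
  intro N f A' φ hφ hft hgal hμ hg
  by_cases hN : 2 ≤ (N : ℕ)
  · exact absurd hμ (not_isMuSaturated A' hN)
  have hN1 : N = 1 := PNat.eq (by have := N.pos; rw [PNat.one_coe]; omega)
  subst hN1
  obtain ⟨g, hg⟩ := hg
  refine ⟨A', 𝟙 A', by rw [Category.id_comp]; exact hφ, hft, hgal, hμ, ?_⟩
  rw [Category.id_comp]
  exact
    { isAmple := ⟨hgal, fun _ _ => ⟨1, (subsingleton_aut_base _).elim _ _⟩⟩
      fixed := fun σ _ => biratAut_apply_eq_self A' σ _
      cond_a := ⟨A', A', 𝟙 _, 𝟙 _, ModelFrobenioid.isPreStep_id _, ModelFrobenioid.isPreStep_id _, hft,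
        trivial⟩
      cond_b := ⟨g, hg⟩ }

end Toy

/-! ## The Kummer-tower toy `ToyCov.biKummerSetting` (p427822): L01 and L02 hold for the genuine transport -/

namespace ToyCov

/-- **L01 `SaturatedRootCover` HOLDS at the Kummer-tower toy** for the genuine transport `pullFracModel`
(row F-2794, model witness): from L01′ `ToyCov.saturatedRootCoverInSkeleton` by pure logic
(`saturatedRootCover_of_inSkeleton`). [cite: MochizukiEtTh2009, Prop 4.2 p.89] -/
theorem saturatedRootCover :
    BiKummerSetting.Prop42Sub.SaturatedRootCover biKummerSetting
      (fun {_ _} φ x => temperedFrobenioid.pullFracModel φ x) :=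
  BiKummerSetting.Prop42Sub.saturatedRootCover_of_inSkeleton _ _ saturatedRootCoverInSkeleton

/-- The [FrdI] Prop. 4.1 (iii) coprimality predicate descends from `N`-th powers (`Φ = ℚ_{≥0}` is sharp:
a common divisor `y` of `a`, `b` divides `y^N ∣ a^N, b^N`, hence `y^N = 1`, hence `y ∣ 1`).
[cite: MochizukiEtTh2009, Prop 4.2 p.89] -/
theorem coprime_of_pow {A : Baseᵒᵖ} {a b : temperedFrobenioid.Φ.carrier A} (N : ℕ+)
    (h : ∀ x : temperedFrobenioid.Φ.carrier A, x ∣ a ^ (N : ℕ) → x ∣ b ^ (N : ℕ) → x = 1)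
    (y : temperedFrobenioid.Φ.carrier A) (hya : y ∣ a) (hyb : y ∣ b) : y = 1 := by
  have hyN : y ^ (N : ℕ) = 1 := h _ (pow_dvd_pow_of_dvd hya _) (pow_dvd_pow_of_dvd hyb _)
  exact (divisorMonoid_isDivisorial A.unop).isSharp.eq_one_of_isUnit y
    (isUnit_of_dvd_one (hyN ▸ dvd_pow_self y (PNat.ne_zero N)))

/-- **L02 `RootFractionPair` HOLDS at the Kummer-tower toy** for the genuine transport `pullFracModel`
(row F-2795, model witness): abc-iut-w5-d134's `rootFractionPair_mkOfModel` (construction of the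
fraction-pair `((1, id, a, g), (1, id, b, 1))` of the root in the model Frobenioid, `Φ` perfect) fed with
`Φ = ℚ_{≥0}` divisorial and the two coprimality laws `coprime_of_pow`, `coprime_pull`.
[cite: MochizukiEtTh2009, Prop 4.2 p.89] -/
theorem rootFractionPair :
    BiKummerSetting.Prop42Sub.RootFractionPair biKummerSetting
      (fun {_ _} φ x => temperedFrobenioid.pullFracModel φ x) :=
  BiKummerSetting.rootFractionPair_mkOfModel temperedFrobenioid
    temperedFrobenioid_monoidType temperedFrobenioid_isPerfect realified.isUnit_BΛ
    (fun {A} a b => ∀ x : temperedFrobenioid.Φ.carrier A, x ∣ a → x ∣ b → x = 1) (fun _ => True)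
    (fun _ _ => 1) galoisSurj_surjective (fun _ _ _ => True)
    (fun {_ _} G α₂ α₁ => temperedFrobenioid.ArisesFromBaseFrobeniusPair G α₂ α₁) Aodot
    isFrobeniusTrivial_Aodot trivial divisorMonoid_isDivisorial
    (fun N h y hya hyb => coprime_of_pow N h y hya hyb) (fun e _ _ h y hya hyb => coprime_pull e h y hya hyb)

end ToyCov

/-! ## Closed forms: the universal closures of the four rows are FALSE -/

namespace BiKummerSetting.Prop42Sub

/-- Automorphism groups in the one-object discrete base category are trivial. [folklore] -/
private theorem subsingleton_aut_base' (A : Discrete PUnit.{1}) : Subsingleton (Aut A) :=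
  ⟨fun _ _ => Iso.ext (Subsingleton.elim _ _)⟩

/-- **Row F-2793: the universal closure of L01b `SaturatedRefinement` is FALSE** — witness: the
canonical model over the perfect toy tempered Frobenioid `Toy.temperedFrobenioidQ` with EMPTY
`(N, H^{bs-fld})`-saturation slot (`not_saturatedRefinement_of_saturationSlot_empty`), transport
`pullFracModel`.  (At the toys of record, slot := `True`, the row HOLDS: `Toy.saturatedRefinement`,
`ToyCov.saturatedRefinement`.) [cite: MochizukiEtTh2009, Prop 4.2 p.90] -/
theorem not_forall_saturatedRefinement :
    ¬ ∀ {K : Type} [Field K] {X : SemiGraphs.TemperedArithmeticGroup.{0} K} {D₀ : Type}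
        [Category.{0} D₀] {V : FrdIMonoidStub.{0}} {T : RealifiedDivisorMonoids (D₀ := D₀) V}
        {D : Type} [Category.{0} D] {VD : FrdICatStub.{0, 0, 0} D} (S : BiKummerSetting X T D VD)
        (pullFrac : ∀ {A A' : S.C} (_ : A' ⟶ A), S.biratUnits A → S.biratUnits A'),
        SaturatedRefinement S pullFrac :=
  fun h => not_saturatedRefinement_of_saturationSlot_empty
    (mkOfModelCanonical Toy.temperedGroup Toy.temperedFrobenioidQ Toy.temperedFrobenioidQ_monoidType
      Toy.temperedFrobenioidQ_isPerfect (fun _ => True) (fun _ _ => 1)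
      (fun A _ _ => ⟨1, (subsingleton_aut_base' A).elim _ _⟩) (fun _ _ _ => False) Toy.Aodot
      Toy.isFrobeniusTrivial_Aodot trivial)
    (fun _ _ _ hslot => hslot) (fun φ x => Toy.temperedFrobenioidQ.pullFracModel φ x) 1 (h _ _)

/-- **Row F-2794: the universal closure of L01 `SaturatedRootCover` is FALSE** — witness: the cover-free
toy `Toy.biKummerSetting` (no `μ_2`-saturated object; `Toy.not_saturatedRootCover`), any transport.
(Model witness where it HOLDS: `ToyCov.saturatedRootCover`.) [cite: MochizukiEtTh2009, Prop 4.2 p.89] -/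
theorem not_forall_saturatedRootCover :
    ¬ ∀ {K : Type} [Field K] {X : SemiGraphs.TemperedArithmeticGroup.{0} K} {D₀ : Type}
        [Category.{0} D₀] {V : FrdIMonoidStub.{0}} {T : RealifiedDivisorMonoids (D₀ := D₀) V}
        {D : Type} [Category.{0} D] {VD : FrdICatStub.{0, 0, 0} D} (S : BiKummerSetting X T D VD)
        (pullFrac : ∀ {A A' : S.C} (_ : A' ⟶ A), S.biratUnits A → S.biratUnits A'),
        SaturatedRootCover S pullFrac :=
  fun h => Toy.not_saturatedRootCover (fun φ x => Toy.temperedFrobenioidQ.pullFracModel φ x) (h _ _)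

/-- **Row F-2795: the universal closure of L02 `RootFractionPair` is FALSE** — witness: the §4 setting over
`Toy.temperedFrobenioidQ` (`A_⊙ = (∗, 0)`, canonical disjoint-supports predicate) with its FREE birational
slots filled degenerately — `O^×(A^birat) := ℤˣ` with trivial `Aut`-action and restrictions,
`s'·(s'')⁻¹ := 1` — and the constant transport `pullFrac := −1`: the trivial fraction-pair `(id, id)` of
`f = 1` on `A_⊙` exists, its first root `g = pullFrac(id)(1) = −1` has NO fraction-pair
(`not_rootFractionPair_of_isEmpty_fractionPair`).  (Model witness where it HOLDS: `ToyCov.rootFractionPair`.)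
[cite: MochizukiEtTh2009, Prop 4.2 p.89] -/
theorem not_forall_rootFractionPair :
    ¬ ∀ {K : Type} [Field K] {X : SemiGraphs.TemperedArithmeticGroup.{0} K} {D₀ : Type}
        [Category.{0} D₀] {V : FrdIMonoidStub.{0}} {T : RealifiedDivisorMonoids (D₀ := D₀) V}
        {D : Type} [Category.{0} D] {VD : FrdICatStub.{0, 0, 0} D} (S : BiKummerSetting X T D VD)
        (pullFrac : ∀ {A A' : S.C} (_ : A' ⟶ A), S.biratUnits A → S.biratUnits A'),
        RootFractionPair S pullFrac := by
  intro h
  let S' : BiKummerSetting Toy.temperedGroup Toy.realifiedQ (Discrete PUnit.{1}) Toy.catVocab :=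
    { Toy.biKummerSetting with
      biratUnits := fun _ => ℤˣ
      instBirat := fun _ => inferInstance
      biratAut := fun _ => 1
      restrictAlong := fun _ _ => MulEquiv.refl _
      fracOf := fun _ _ _ _ _ => 1 }
  have P : S'.FractionPair (A := S'.Aodot) 1 S'.Aodot :=
    { num := 𝟙 _
      den := 𝟙 _
      isPreStep_num := ModelFrobenioid.isPreStep_id _
      isPreStep_den := ModelFrobenioid.isPreStep_id _
      base_eq := rfl
      frac_eq := rfl
      disjointSupports := fun x hx _ =>
        (Toy.divisorMonoidQ_isDivisorial (Discrete.mk PUnit.unit)).isSharp.eq_one_of_isUnit x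
          (isUnit_of_dvd_one hx) }
  have hno : ∀ BN : S'.C, IsEmpty (S'.FractionPair (A := S'.Aodot) (-1) BN) := fun BN =>
    ⟨fun Q => by
      have hQ : (1 : ℤˣ) = -1 := Q.frac_eq
      exact absurd hQ (by decide)⟩
  exact not_rootFractionPair_of_isEmpty_fractionPair S' (pullFrac := fun _ _ => -1) P hno
    (h S' fun _ _ => -1)

/-- **Row F-2796: the universal closure of L03 `BaseFrobeniusLift` is FALSE** — the closed form of
abc-iut-w5-d063's `ToyCov.not_baseFrobeniusLift_and_baseFrobeniusLiftUpToUnit` (p430911): at the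
Kummer-tower toy the non-trivial constant unit `−1 ∈ O^×(A_⊙) = ℂˣ` fires abc-iut-w4-d044's finding
F-w4d044-1 (`not_baseFrobeniusLift_mkOfModelCanonical`; a base-section is a skeleton, [FrdI] Def. 2.7 (i)),
while the superseding row L03′ `BaseFrobeniusLiftUpToUnit` holds there. [cite: MochizukiEtTh2009, Prop 4.2 p.89] -/
theorem not_forall_baseFrobeniusLift :
    ¬ ∀ {K : Type} [Field K] {X : SemiGraphs.TemperedArithmeticGroup.{0} K} {D₀ : Type}
        [Category.{0} D₀] {V : FrdIMonoidStub.{0}} {T : RealifiedDivisorMonoids (D₀ := D₀) V}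
        {D : Type} [Category.{0} D] {VD : FrdICatStub.{0, 0, 0} D} (S : BiKummerSetting X T D VD),
        BaseFrobeniusLift S :=
  fun h => ToyCov.not_baseFrobeniusLift_and_baseFrobeniusLiftUpToUnit.1 (h _)

/-- **Summary for the four rows F-2793 … F-2796**: each universal closure is refuted, and for L01b, L01,
L02 an explicit §4 setting and transport at which the row HOLDS is on record (`Toy.saturatedRefinement`,
`ToyCov.saturatedRootCover`, `ToyCov.rootFractionPair`) — the rows are schemata to be consumed per
instance, never closed `∀`-hypotheses. [cite: MochizukiEtTh2009, Prop 4.2 p.88] -/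
theorem rows_F2793_F2796_schema_verdict :
    (¬ ∀ {K : Type} [Field K] {X : SemiGraphs.TemperedArithmeticGroup.{0} K} {D₀ : Type}
        [Category.{0} D₀] {V : FrdIMonoidStub.{0}} {T : RealifiedDivisorMonoids (D₀ := D₀) V}
        {D : Type} [Category.{0} D] {VD : FrdICatStub.{0, 0, 0} D} (S : BiKummerSetting X T D VD)
        (pullFrac : ∀ {A A' : S.C} (_ : A' ⟶ A), S.biratUnits A → S.biratUnits A'),
        SaturatedRefinement S pullFrac) ∧
    (¬ ∀ {K : Type} [Field K] {X : SemiGraphs.TemperedArithmeticGroup.{0} K} {D₀ : Type}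
        [Category.{0} D₀] {V : FrdIMonoidStub.{0}} {T : RealifiedDivisorMonoids (D₀ := D₀) V}
        {D : Type} [Category.{0} D] {VD : FrdICatStub.{0, 0, 0} D} (S : BiKummerSetting X T D VD)
        (pullFrac : ∀ {A A' : S.C} (_ : A' ⟶ A), S.biratUnits A → S.biratUnits A'),
        SaturatedRootCover S pullFrac) ∧
    (¬ ∀ {K : Type} [Field K] {X : SemiGraphs.TemperedArithmeticGroup.{0} K} {D₀ : Type}
        [Category.{0} D₀] {V : FrdIMonoidStub.{0}} {T : RealifiedDivisorMonoids (D₀ := D₀) V}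
        {D : Type} [Category.{0} D] {VD : FrdICatStub.{0, 0, 0} D} (S : BiKummerSetting X T D VD)
        (pullFrac : ∀ {A A' : S.C} (_ : A' ⟶ A), S.biratUnits A → S.biratUnits A'),
        RootFractionPair S pullFrac) ∧
    (¬ ∀ {K : Type} [Field K] {X : SemiGraphs.TemperedArithmeticGroup.{0} K} {D₀ : Type}
        [Category.{0} D₀] {V : FrdIMonoidStub.{0}} {T : RealifiedDivisorMonoids (D₀ := D₀) V}
        {D : Type} [Category.{0} D] {VD : FrdICatStub.{0, 0, 0} D} (S : BiKummerSetting X T D VD),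
        BaseFrobeniusLift S) ∧
    (∀ pullFrac : ∀ {A A' : Toy.biKummerSetting.C} (_ : A' ⟶ A),
        Toy.biKummerSetting.biratUnits A → Toy.biKummerSetting.biratUnits A',
        SaturatedRefinement Toy.biKummerSetting pullFrac) ∧
    SaturatedRootCover ToyCov.biKummerSetting
      (fun {_ _} φ x => ToyCov.temperedFrobenioid.pullFracModel φ x) ∧
    RootFractionPair ToyCov.biKummerSetting
      (fun {_ _} φ x => ToyCov.temperedFrobenioid.pullFracModel φ x) :=
  ⟨not_forall_saturatedRefinement, not_forall_saturatedRootCover, not_forall_rootFractionPair,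
    not_forall_baseFrobeniusLift, Toy.saturatedRefinement, ToyCov.saturatedRootCover,
    ToyCov.rootFractionPair⟩

end BiKummerSetting.Prop42Sub

end Literature.AnabelianGeometry.EtaleTheta
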